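import Summits.QuantumFields.YangMills.Theorems.BalabanUVNodesN08AlphaRegSel

/-!
# Route «BalabanUVNodes», Track-A DAG node N08 = [Balaban1985UV3] — THE (α) CLAUSE: the in-edge conclusion (b7) THROUGH SCALE 1 — the lift and
# its one-step average (42) of [4] are continuous on [7]'s regular class, in the topology of the realisation

Cell `pub-ymgap`, seat `pub-ymgap-dag-n08-d` gen 4, file 5 (director-ym R134 row «CLASS-I in-edge conclusions at the (α) granularity of `RunAlpha`»).
`bears_on: R4∕N08`; filed `--supports stmt-QuantumFields-19903 --as helper`.  Sorry-free, standard axioms.  After this seat's files 1a∕1b∕2∕3∕4 the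
(α) clause's in-edge side is reduced to two DISPLAYED in-edge conclusions, (b7) «the lifted `j`-fold averages `U ↦ Ū^j(lift U)(z, κ)` at the bonds of
`Λ_j(h)`, `j < k`, are continuous on `regClass 𝔊 𝔠 k h` in `rhoTopology 𝔊`» and (b11) «(42) is solvable in the class».  THIS FILE proves (b7) for the
two lowest scales `j = 0, 1` — i.e. discharges it for every step `k ≤ 2` — from the in-edge b7's OWN kernel theorems:
* §1 `continuous_val_hol_liftCfg`: every parallel transport (9) of the lift, `U ↦ (lift U)(Γ)`, is continuous (induction on the word; `ρ` continuous,
  §1 of file 1a); hence scale `j = 0` (`Ū^0 = U`): `continuous_val_liftAvg_zero`, everywhere.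
* §2 scale `j = 1`: on [7]'s class the scale-0 clause is GLOBAL (`Ω_0(h) = T_η`, `Omega_level_zero`) with constant `α₀ = C68·g_0p(g_0)`; under the
  window `512(d+1)(d+4)L²α₀ ≤ 1` every loop variable `(lift U)(Γ_{c,x})(lift U)(c)⁻¹` is within `2θ ≤ 1/32` of `1`
  ([Balaban1985Averaging] p. 25, tree `B7Prop2Explicit.norm_Wcx_sub_one_le`), where the logarithmic series (21) is analytic
  (`MatrixLog.analyticAt_mlog`), so `U ↦ Ū^1(lift U)(z, κ) = exp[Σ_x L^{−d} log(…)]·(lift U)(c)` is continuous AT every point of the class: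
  ★ `continuousOn_val_liftAvg_one`.
* §3 `hcont_of_le_two`: the hypothesis (b7) of files 3∕4 (`exists_externalInputs_faces₃` ∕ `exists_externalInputs_runAlpha`) HOLDS for all steps
  `k ≤ 2` under that window — scales `j ≥ 2` need [4] Prop. 2's induction «averages of regular configurations stay regular» region by region (located).
HONEST FRAMING: kernel theorems over the tree's own objects ([4]'s (42), (21), p. 25 estimate BY NAME); nothing of [B10] asserted; count-neutral; NOT a
discharge of N08.  d = 3 lattice gauge theory on finite tori as printed; nothing about d = 4, the continuum, OS axioms, a mass gap or the Clay problem.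
-/

noncomputable section

namespace Summit.QuantumFields.YangMills.Theorems.BalabanUVNodesN08AlphaB7Scale1

open MeasureTheory Set Topology TopologicalSpace NormedSpace
open scoped Matrix Matrix.Norms.L2Operator BigOperators
open Literature.MathematicalPhysics.QuantumFieldTheory.Balaban1983to89
open Literature.MathematicalPhysics.QuantumFieldTheory.Balaban1983to89.B10 (pFun)
open Literature.MathematicalPhysics.QuantumFieldTheory.Balaban1985CMP102.Setting
open Summit.QuantumFields.Balaban3D.Carriers
open Summit.QuantumFields.Balaban3D.Proofs.Primitives (AlphaConsts)
open Summit.QuantumFields.Balaban3D.Proofs.LiftBridge (liftCfg liftCfg_mem_unitaryUnits)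
open Summit.QuantumFields.Balaban3D.Proofs.TorusLift (projSite projSite_add_e)
open Summit.QuantumFields.Balaban3D.Proofs.ScalesArithmetic (gk_pos gk_le_one)
open Summit.QuantumFields.YangMills.Theorems.BalabanUVNodesN08AlphaClassI (RegLift)
open Summit.QuantumFields.YangMills.Theorems.BalabanUVNodesN08AlphaGroupTopology
open Summit.QuantumFields.YangMills.Theorems.BalabanUVNodesN08AlphaRegSel
open B7Prop1Explicit (hol plaqWord e stepHol Letter Wcx Xavg bavg boxVec seg expUnit val_expUnit hol_nil hol_cons Wcx_eq_hol_loop U1)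
open B7Prop2Explicit (avgIter avgIter_zero avgIter_succ rescale_apply unitaryUnits_le_U1 norm_Wcx_sub_one_le)

variable {L : ℕ}

/-! ## §1 Parallel transports of the lift are continuous; scale `j = 0` -/

section Transport

variable {S : Scales L} {G : Type} [GaugeGroup G] [MeasurableSpace G] (𝔊 : GroupModel G)

/-- The bond variable of the lift traversed by a letter is a continuous function of the torus configuration (`ρ(U(b))` or `ρ(U(b)⁻¹)`). [folklore] -/
theorem continuous_val_stepHol_liftCfg (x : B7Prop1Explicit.Site S.P.d) (l : Letter S.P.d) :
    letI := rhoTopology 𝔊; Continuous fun U : GaugeField S.P 0 G =>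
      ((stepHol (liftCfg 𝔊 U) x l : (Matrix (Fin 𝔊.N) (Fin 𝔊.N) ℂ)ˣ) : Matrix (Fin 𝔊.N) (Fin 𝔊.N) ℂ) := by
  letI := rhoTopology 𝔊
  haveI := continuousInv_rho 𝔊
  have hb : ∀ b : PBond S.P 0, Continuous fun U : GaugeField S.P 0 G => U b := fun b => continuous_apply b
  obtain ⟨μ, b⟩ := l
  cases b with
  | true =>
    simp only [stepHol, if_true, liftCfg, MonoidHom.coe_toHomUnits]
    exact (continuous_rho 𝔊).comp (hb _)
  | false =>
    simp only [stepHol, liftCfg, ← map_inv]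
    exact (continuous_rho 𝔊).comp ((hb _).inv)

/-- **Every parallel transport (9) of the lift, `U ↦ (lift U)(Γ)`, is continuous** in the topology of the realisation. [cite: Balaban1985Averaging, (9) p.18] -/
theorem continuous_val_hol_liftCfg (w : List (Letter S.P.d)) :
    letI := rhoTopology 𝔊; ∀ x : B7Prop1Explicit.Site S.P.d, Continuous fun U : GaugeField S.P 0 G =>
      ((hol (liftCfg 𝔊 U) x w : (Matrix (Fin 𝔊.N) (Fin 𝔊.N) ℂ)ˣ) : Matrix (Fin 𝔊.N) (Fin 𝔊.N) ℂ) := by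
  letI := rhoTopology 𝔊
  induction w with
  | nil =>
    intro x
    simp only [hol_nil, Units.val_one]
    exact continuous_const
  | cons l w ih =>
    intro x
    simp only [hol_cons, Units.val_mul]
    exact (continuous_val_stepHol_liftCfg 𝔊 x l).mul (ih (x + l.vec))

/-- **(b7) AT SCALE `j = 0`**: `Ū^0(lift U)(z, κ) = ρ(U(proj z, κ))` is continuous EVERYWHERE. [cite: Balaban1985Averaging, (43) p.24] -/
theorem continuous_val_liftAvg_zero (z : B7Prop1Explicit.Site S.P.d) (κ : Fin S.P.d) :
    letI := rhoTopology 𝔊; Continuous fun U : GaugeField S.P 0 G =>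
      ((avgIter L (liftCfg 𝔊 U) 0 z κ : (Matrix (Fin 𝔊.N) (Fin 𝔊.N) ℂ)ˣ) : Matrix (Fin 𝔊.N) (Fin 𝔊.N) ℂ) := by
  letI := rhoTopology 𝔊
  simp only [avgIter_zero, liftCfg, MonoidHom.coe_toHomUnits]
  exact (continuous_rho 𝔊).comp (continuous_apply _)

end Transport

/-! ## §2 Scale `j = 1`: the one-step average (42) of the lift is continuous on [7]'s class -/

section ScaleOne

variable {S : Scales L} {G : Type} [GaugeGroup G] [MeasurableSpace G] (𝔊 : GroupModel G) (𝔠 : AlphaConsts L 𝔊.N)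

omit [MeasurableSpace G] in
/-- `Ω_0(h) = T_η` for every history (the level-`0` region is the whole torus at every step). [cite: Balaban1985UV3, (42) p.266 («Λ₀ = Ω₁ᶜ», Ω₀ = T)] -/
theorem Omega_level_zero (M₁ : ℕ) (Rcol : ℕ → ℕ) : ∀ (k : ℕ) (h : Hist S.P k), Omega M₁ Rcol k h 0 = Set.univ
  | 0, _ => rfl
  | k + 1, h => by rw [Omega_succ_of_le M₁ Rcol h (Nat.zero_le k)]; exact Omega_level_zero M₁ Rcol k h.proj

/-- **On [7]'s class the scale-`0` plaquette clause is GLOBAL**: for `1 ≤ k`, every unit plaquette of the lift of a member of `regClass 𝔊 𝔠 k h` is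
within `α₀ = C68·g_0p(g_0)` of `1`. [cite: Balaban1985Variational, (2) p.278] -/
theorem plaq_le_of_mem_regClass {k : ℕ} (hk : 1 ≤ k) (h : Hist S.P k) {U : GaugeField S.P 0 G} (hU : U ∈ regClass 𝔊 𝔠 k h)
    (x : B7Prop1Explicit.Site S.P.d) (μ ν : Fin S.P.d) (hμν : μ ≠ ν) :
    ‖((hol (liftCfg 𝔊 U) x (plaqWord μ ν) : (Matrix (Fin 𝔊.N) (Fin 𝔊.N) ℂ)ˣ) : Matrix (Fin 𝔊.N) (Fin 𝔊.N) ℂ) - 1‖ ≤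
      𝔠.C68 * (S.gk 0 * pFun 𝔠.lane.carrier.b₀ 𝔠.lane.carrier.p₀ (S.gk 0)) := by
  have h0 := hU 0 (by omega)
  rw [Omega_level_zero] at h0
  have := h0 x μ ν hμν (Or.inl (Set.mem_univ _))
  simp only [pow_zero, inv_one, one_pow, mul_one] at this
  exact this.le

/-- The one-step average (42)–(43) of the lift at scale `1`, spelled out: `Ū^1(lift U)(z, κ) = exp[X_{c}]·(lift U)(c)`, `c = (Lz, Lz + Le_κ)`.
[cite: Balaban1985Averaging, (42)–(43) pp.23–24] -/
theorem val_liftAvg_one (U : GaugeField S.P 0 G) (z : B7Prop1Explicit.Site S.P.d) (κ : Fin S.P.d) :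
    ((avgIter L (liftCfg 𝔊 U) 1 z κ : (Matrix (Fin 𝔊.N) (Fin 𝔊.N) ℂ)ˣ) : Matrix (Fin 𝔊.N) (Fin 𝔊.N) ℂ) =
      exp (Xavg L (liftCfg 𝔊 U) ((L : ℤ) • z) κ) *
        ((hol (liftCfg 𝔊 U) ((L : ℤ) • z) (seg κ L) : (Matrix (Fin 𝔊.N) (Fin 𝔊.N) ℂ)ˣ) : Matrix (Fin 𝔊.N) (Fin 𝔊.N) ℂ) := by
  simp only [avgIter_succ, avgIter_zero, rescale_apply, bavg, Units.val_mul, val_expUnit]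

/-- **★ (b7) AT SCALE `j = 1`: the one-step average of the lift is continuous ON [7]'s class** (`1 ≤ k`), under the window
`512(d+1)(d+4)L²·C68·g_0p(g_0) ≤ 1`: at every member of the class every `log`-argument `(lift U)(Γ_{c,x})(lift U)(c)⁻¹` is within `2θ ≤ 1/32` of `1`
(p. 25, `norm_Wcx_sub_one_le`), where (21) is analytic (`analyticAt_mlog`), so `U ↦ Ū^1(lift U)(z, κ)` is continuous at that member.
[cite: Balaban1985Averaging, (42) p.23 + (21) p.21 + p.25 (displays before (47))] -/
theorem continuousOn_val_liftAvg_one {k : ℕ} (hk : 1 ≤ k) (h : Hist S.P k) (hL : 1 ≤ L)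
    (hwin : 512 * ((S.P.d : ℝ) + 1) * (S.P.d + 4) * (L : ℝ) ^ 2 * (𝔠.C68 * (S.gk 0 * pFun 𝔠.lane.carrier.b₀ 𝔠.lane.carrier.p₀ (S.gk 0))) ≤ 1)
    (z : B7Prop1Explicit.Site S.P.d) (κ : Fin S.P.d) :
    letI := rhoTopology 𝔊; ContinuousOn (fun U : GaugeField S.P 0 G =>
      ((avgIter L (liftCfg 𝔊 U) 1 z κ : (Matrix (Fin 𝔊.N) (Fin 𝔊.N) ℂ)ˣ) : Matrix (Fin 𝔊.N) (Fin 𝔊.N) ℂ)) (regClass 𝔊 𝔠 k h) := by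
  letI := rhoTopology 𝔊
  haveI : NeZero 𝔊.N := ⟨Nat.pos_iff_ne_zero.mp 𝔊.N_pos⟩
  letI : CStarAlgebra (Matrix (Fin 𝔊.N) (Fin 𝔊.N) ℂ) := {}
  letI : NormedAlgebra ℚ (Matrix (Fin 𝔊.N) (Fin 𝔊.N) ℂ) := NormedAlgebra.restrictScalars ℚ ℂ _
  refine continuousOn_of_forall_continuousAt fun U₀ hU₀ => ?_
  simp only [val_liftAvg_one]
  -- the loop variables at `U₀` are within `2θ < 1` of `1`
  have hα₀ : 0 ≤ 𝔠.C68 * (S.gk 0 * pFun 𝔠.lane.carrier.b₀ 𝔠.lane.carrier.p₀ (S.gk 0)) := by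
    have hg0 : 0 < S.gk 0 := gk_pos S 0
    have hg1 : S.gk 0 ≤ 1 := gk_le_one S S.gK_le_one 0 (Nat.zero_le _)
    have hp : 0 < pFun 𝔠.lane.carrier.b₀ 𝔠.lane.carrier.p₀ (S.gk 0) :=
      Summit.QuantumFields.Balaban3D.Proofs.CouplingWindow.pFun_pos _ _ _ (show 0 < 𝔠.b₀ from 𝔠.b₀_pos) hg0 hg1
    exact (mul_pos 𝔠.C68_pos (mul_pos hg0 hp)).le
  have hU1 : ∀ x κ', liftCfg 𝔊 U₀ x κ' ∈ U1 (Matrix (Fin 𝔊.N) (Fin 𝔊.N) ℂ) := fun x κ' =>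
    unitaryUnits_le_U1 (liftCfg_mem_unitaryUnits 𝔊 U₀ x κ')
  have hW : ∀ r : Fin S.P.d → Fin L,
      ‖((Wcx L (liftCfg 𝔊 U₀) ((L : ℤ) • z) κ (boxVec L r) : (Matrix (Fin 𝔊.N) (Fin 𝔊.N) ℂ)ˣ) : Matrix (Fin 𝔊.N) (Fin 𝔊.N) ℂ) - 1‖ < 1 := by
    intro r
    refine (norm_Wcx_sub_one_le L hL (liftCfg 𝔊 U₀) hU1 hα₀ hwin
      (fun x μ ν hμν => plaq_le_of_mem_regClass 𝔊 𝔠 hk h hU₀ x μ ν hμν) ((L : ℤ) • z) κ r).trans_lt ?_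
    have hd : (0 : ℝ) ≤ S.P.d := Nat.cast_nonneg _
    nlinarith
  -- continuity at `U₀` of each `log`-term, of their sum, of `exp`, and of the transport along `c`
  have hWc : ∀ r : Fin S.P.d → Fin L, Continuous fun U : GaugeField S.P 0 G =>
      ((Wcx L (liftCfg 𝔊 U) ((L : ℤ) • z) κ (boxVec L r) : (Matrix (Fin 𝔊.N) (Fin 𝔊.N) ℂ)ˣ) : Matrix (Fin 𝔊.N) (Fin 𝔊.N) ℂ) := by
    intro r
    simp only [Wcx_eq_hol_loop]
    exact continuous_val_hol_liftCfg 𝔊 _ _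
  have hterm : ∀ r : Fin S.P.d → Fin L, ContinuousAt (fun U : GaugeField S.P 0 G =>
      MatrixLog.mlog ((Wcx L (liftCfg 𝔊 U) ((L : ℤ) • z) κ (boxVec L r) : (Matrix (Fin 𝔊.N) (Fin 𝔊.N) ℂ)ˣ) :
        Matrix (Fin 𝔊.N) (Fin 𝔊.N) ℂ)) U₀ := fun r =>
    ContinuousAt.comp (f := fun U : GaugeField S.P 0 G =>
      ((Wcx L (liftCfg 𝔊 U) ((L : ℤ) • z) κ (boxVec L r) : (Matrix (Fin 𝔊.N) (Fin 𝔊.N) ℂ)ˣ) : Matrix (Fin 𝔊.N) (Fin 𝔊.N) ℂ))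
      (MatrixLog.analyticAt_mlog (hW r)).continuousAt (hWc r).continuousAt
  have hX : ContinuousAt (fun U : GaugeField S.P 0 G => Xavg L (liftCfg 𝔊 U) ((L : ℤ) • z) κ) U₀ := by
    simp only [Xavg]
    exact tendsto_finsetSum _ fun r _ => (hterm r).const_smul _
  exact ((exp_continuous.continuousAt.comp hX).mul (continuous_val_hol_liftCfg 𝔊 _ _).continuousAt)

end ScaleOne

/-! ## §3 (b7) of files 3∕4 holds for every step `k ≤ 2` -/

section Hcont

variable {S : Scales L} {G : Type} [GaugeGroup G] [MeasurableSpace G] (𝔊 : GroupModel G) (𝔠 : AlphaConsts L 𝔊.N)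

/-- **(b7) THROUGH SCALE 1**: for every step `k ≤ 2` and history `h`, the hypothesis `hcont` of `BalabanUVNodesN08AlphaInB42Sel.exists_externalInputs_faces₃`
∕ `BalabanUVNodesN08AlphaSelEnd.exists_externalInputs_runAlpha` — continuity of the lifted `j`-fold averages, `j < k`, on `regClass 𝔊 𝔠 k h` at the bonds of
`Λ_j(h)` — HOLDS (indeed at every bond), under the window `512(d+1)(d+4)L²·C68·g_0p(g_0) ≤ 1`. [cite: Balaban1985Averaging, (42)–(43) pp.23–24 + p.25] -/
theorem hcont_of_le_two (hL : 1 ≤ L)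
    (hwin : 512 * ((S.P.d : ℝ) + 1) * (S.P.d + 4) * (L : ℝ) ^ 2 * (𝔠.C68 * (S.gk 0 * pFun 𝔠.lane.carrier.b₀ 𝔠.lane.carrier.p₀ (S.gk 0))) ≤ 1)
    (k : ℕ) (hk : k ≤ 2) (h : Hist S.P k) :
    letI := rhoTopology 𝔊; ∀ j < k, ∀ (z : B7Prop1Explicit.Site S.P.d) (κ : Fin S.P.d),
      projSite (((L : ℤ) ^ j) • z) ∈ Lam 𝔠.lane.carrier.M₁ (rcolOf S 𝔠.lane.carrier) h j →
      projSite (((L : ℤ) ^ j) • (z + e κ)) ∈ Lam 𝔠.lane.carrier.M₁ (rcolOf S 𝔠.lane.carrier) h j →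
      ContinuousOn (fun U : GaugeField S.P 0 G => ((avgIter L (liftCfg 𝔊 U) j z κ : (Matrix (Fin 𝔊.N) (Fin 𝔊.N) ℂ)ˣ) :
        Matrix (Fin 𝔊.N) (Fin 𝔊.N) ℂ)) (regClass 𝔊 𝔠 k h) := by
  letI := rhoTopology 𝔊
  intro j hj z κ _ _
  match j, hj with
  | 0, _ => exact (continuous_val_liftAvg_zero 𝔊 z κ).continuousOn
  | 1, hj1 => exact continuousOn_val_liftAvg_one 𝔊 𝔠 (by omega) h hL hwin z κ
  | j + 2, hj2 => exact absurd hj2 (by omega)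

end Hcont

end Summit.QuantumFields.YangMills.Theorems.BalabanUVNodesN08AlphaB7Scale1

end
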